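import Summits.AnomalousDissipation.AnomalousDissipation.Theorems.SolenoidalFractalHomogenisationLagrangianStepSidebandLadderDecay
import Summits.AnomalousDissipation.AnomalousDissipation.Theorems.SolenoidalFractalHomogenisationLagrangianStepSidebandMaskDefs
import Summits.AnomalousDissipation.AnomalousDissipation.Theorems.SolenoidalFractalHomogenisationLagrangianStepSidebandResponseTransversal
import Summits.AnomalousDissipation.AnomalousDissipation.Theorems.SolenoidalFractalHomogenisationLagrangianStepLadderHypocoerciveStart
import HarnessLib

/-!
# K1L_D `stub_D1_V0thg` (stmt-AnomalousDissipation-27980), R3′ lane «SidebandTailCrushing» (tenure D28-16 (3) / D28-20) — file F4f: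
# LADDER INVARIANCE — a trajectory of the truncated sideband system that starts in a ladder subspace stays in it during the slot

Helper file of route `SolenoidalFractalHomogenisation` (prover seat `ad-k1l-cellLawV-w1` g10; `--supports stmt-AnomalousDissipation-27980 --as helper`).
It discharges the hypothesis `huV` of `Sideband.ladder_decay` (file F4e): if `u′ = gen(t) u` on `[t₀, t₁]` inside slot `i` (all other envelopes off)
and `u t₀ ∈ ladderSub R (ladder z₀ mᵢ)`, then `u t ∈ ladderSub R (ladder z₀ mᵢ)` for all `t ∈ [t₀, t₁]`.
Mechanism: the real-linear projection `P = maskL R L ∘ projX 1 0 R` (kill the fibres off the ladder, Leray-project the others) maps `Space R` into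
the ladder subspace, fixes it, and COMMUTES with `gen(t)` on the slot window (`projX_gen_comm`; the mask commutes with `dampL` fibrewise and with
`hopLᵢ` because a ladder is closed under `± mᵢ`); hence `w = u − P u` solves the same equation with `w(t₀) = 0`, and `‖w‖²` is non-increasing
(`LadderCrush.norm_sq_antitoneOn`: `hopL` is skew, `⟪dampL v, v⟫_ℝ ≥ 0`), so `w ≡ 0`.
No definitions, no sorry.  NOT a proof of `stub_D1_V0thg`, of K1L_D or of AD; rung F-D1.A0 infrastructure.
-/

set_option linter.dupNamespace false -- single-conjunct summit: `Summit.AnomalousDissipation.AnomalousDissipation.…` is the mandated namespace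

noncomputable section

namespace Summit.AnomalousDissipation.AnomalousDissipation.Theorems.SolenoidalFractalHomogenisation.LagrangianStep.Sideband

open Set Complex
open scoped InnerProductSpace
open Literature.Analysis Literature.Analysis.FunctionSpaces Literature.Analysis.FunctionSpaces.Torus
open Literature.Analysis.FluidPDE Literature.Analysis.FluidPDE.Torus Literature.Analysis.FluidPDE.LatticeShear
open Summit.AnomalousDissipation.AnomalousDissipation.Theorems.SolenoidalFractalHomogenisation.LagrangianStep.CellChain
  (kdot_transversalProj')

variable {k₀ : ℕ}

/-! ## §1 The mask commutes with the slot's link operator and with the damping -/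

/-- **The ladder mask commutes with the slot's link operator**: a ladder `z₀ + ℤmᵢ` is closed under `± mᵢ`, and `(hopLᵢ y)_z` only reads the
fibres `z ∓ mᵢ`. [cite: MeshalkinSinai1961, pp. 1700–1705] -/
theorem maskL_hopL_comm_ladder (W₁ : LatticeWord k₀) (R : ℕ) (i : Fin k₀) (z₀ : Fin 3 → ℤ) (y : Space R) :
    maskL R (ladder z₀ (W₁.phase i).m) (hopL W₁ R i y) = hopL W₁ R i (maskL R (ladder z₀ (W₁.phase i).m) y) := by
  apply PiLp.ext
  intro z
  rw [maskL_apply, hopL_apply, hopL_apply, linkBlock_apply, linkBlock_apply]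
  by_cases hz : (z : Fin 3 → ℤ) ∈ ladder z₀ (W₁.phase i).m
  · rw [if_pos hz, coordL_maskL_of_mem (sub_mem_ladder hz), coordL_maskL_of_mem (add_mem_ladder hz)]
  · rw [if_neg hz, coordL_maskL_of_not_mem (fun h => hz (sub_mem_ladder_iff.1 h)),
      coordL_maskL_of_not_mem (fun h => hz (add_mem_ladder_iff.1 h)), map_zero, map_zero, smul_zero, smul_zero, add_zero, map_zero,
      smul_zero]

/-- **Any coordinate mask commutes with the damping** (the damping is fibrewise). [cite: MajdaKramer1999, §2.2.1.3 (cell problem (49))] -/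
theorem maskL_dampL_comm (R : ℕ) (A : Set (Fin 3 → ℤ)) (𝔸 : Torus.Visc4 (Fin 3)) (γ₁ : ℝ) (y : Space R) :
    maskL R A (dampL 𝔸 γ₁ R y) = dampL 𝔸 γ₁ R (maskL R A y) := by
  apply PiLp.ext
  intro z
  rw [maskL_apply, dampL_apply, dampL_apply, dampComp_apply, dampComp_apply, maskL_apply]
  by_cases hz : (z : Fin 3 → ℤ) ∈ A
  · rw [if_pos hz, if_pos hz]
  · have h0 : Torus.symbT (Torus.majorTranspose 𝔸) z.1 0 = 0 := (symbTL (Torus.majorTranspose 𝔸) z.1).map_zero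
    rw [if_neg hz, if_neg hz, map_zero, h0, map_zero, smul_zero, sub_zero, smul_zero, add_zero]

/-- **The mask commutes with the generator on the slot window** (only slot `i` active): `gen(t) = envᵢ(t)•hopLᵢ − dampL`.
[cite: MajdaKramer1999, §2.2.1.3 (cell problem (49))] -/
theorem maskL_gen_comm_of_slot (W₁ : LatticeWord k₀) (𝔸 : Torus.Visc4 (Fin 3)) (γ₁ : ℝ) (R : ℕ) (i : Fin k₀) (z₀ : Fin 3 → ℤ) {t : ℝ}
    (hoff : ∀ j, j ≠ i → slotEnvelope W₁ j t = 0) (y : Space R) :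
    maskL R (ladder z₀ (W₁.phase i).m) (gen W₁ 𝔸 γ₁ R t y) = gen W₁ 𝔸 γ₁ R t (maskL R (ladder z₀ (W₁.phase i).m) y) := by
  rw [gen_eq_of_slot W₁ 𝔸 γ₁ R i hoff, sub_apply, sub_apply, smul_apply, smul_apply, map_sub, map_smul, maskL_hopL_comm_ladder,
    maskL_dampL_comm]

/-! ## §2 The ladder projection `maskL ∘ projX 1 0` -/

/-- `maskL R L (projX 1 0 R y)` lies in the ladder subspace of `L`. [cite: Temam1984, Ch. III §1.1] -/
theorem maskL_projX_mem_ladderSub (R : ℕ) (L : Set (Fin 3 → ℤ)) (y : Space R) : maskL R L (projX 1 0 R y) ∈ ladderSub R L := by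
  refine mem_ladderSub.2 fun z => ⟨fun hz => maskL_apply_of_not_mem hz _, ?_⟩
  by_cases hz : (z : Fin 3 → ℤ) ∈ L
  · rw [maskL_apply_of_mem hz, projX_one_zero_apply]; exact kdot_transversalProj' _ _
  · rw [maskL_apply_of_not_mem hz, map_zero]

/-- On the ladder subspace the ladder projection is the identity. [cite: Temam1984, Ch. III §1.1] -/
theorem maskL_projX_eq_self_of_mem_ladderSub {R : ℕ} {L : Set (Fin 3 → ℤ)} {y : Space R} (hy : y ∈ ladderSub R L) :
    maskL R L (projX 1 0 R y) = y := by
  apply PiLp.ext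
  intro z
  by_cases hz : (z : Fin 3 → ℤ) ∈ L
  · rw [maskL_apply_of_mem hz, projX_one_zero_apply, transversalProj_apply_of_mem_ladderSub hy]
  · rw [maskL_apply_of_not_mem hz, apply_eq_zero_of_mem_ladderSub hy hz]

/-! ## §3 Invariance of the ladder subspace along the flow -/

set_option maxHeartbeats 400000 in -- pre-budgeted (ops-buildfix rule)
/-- **LADDER INVARIANCE.**  Let `u′ = gen(t) u` on `[t₀, t₁]` inside slot `i` (all other envelopes off), `NearIso 𝔸 lo' hi'` with `lo' ≥ 0`, `γ₁ ≥ 0`.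
If `u t₀ ∈ ladderSub R (ladder z₀ mᵢ)` then `u t ∈ ladderSub R (ladder z₀ mᵢ)` for every `t ∈ [t₀, t₁]` — the hypothesis `huV` of `ladder_decay`.
Proof: `w = u − P u` with `P = maskL ∘ projX 1 0` solves `w′ = envᵢ•hopL w − dampL w`, `w t₀ = 0`, and `‖w‖²` is non-increasing.
[cite: MajdaKramer1999, §2.2.1.3 (cell problem (49))] -/
theorem mem_ladderSub_of_flow (W₁ : LatticeWord k₀) {R : ℕ} (i : Fin k₀) (z₀ : Fin 3 → ℤ)
    {𝔸 : Torus.Visc4 (Fin 3)} {lo' hi' : ℝ} (h𝔸 : Torus.NearIso 𝔸 lo' hi') (hlo' : 0 ≤ lo') {γ₁ : ℝ} (hγ₁ : 0 ≤ γ₁)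
    {u : ℝ → Space R} {t₀ t₁ : ℝ}
    (hu : ∀ t ∈ Icc t₀ t₁, HasDerivAt u (((gen W₁ 𝔸 γ₁ R t).restrictScalars ℝ) (u t)) t)
    (hoff : ∀ t ∈ Icc t₀ t₁, ∀ j, j ≠ i → slotEnvelope W₁ j t = 0)
    (h0 : u t₀ ∈ ladderSub R (ladder z₀ (W₁.phase i).m)) :
    ∀ t ∈ Icc t₀ t₁, u t ∈ ladderSub R (ladder z₀ (W₁.phase i).m) := by
  intro t ht
  -- the ladder projection, as a real operator, and the defect `w = u − P u`
  let P : Space R →L[ℝ] Space R := ((maskL R (ladder z₀ (W₁.phase i).m)).comp (projX 1 0 R)).restrictScalars ℝ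
  have hPapp : ∀ y, P y = maskL R (ladder z₀ (W₁.phase i).m) (projX 1 0 R y) := fun y => rfl
  let w : ℝ → Space R := fun s => u s - P (u s)
  have hwapp : ∀ s, w s = u s - P (u s) := fun s => rfl
  -- the players of `LadderCrush.norm_sq_antitoneOn`
  let H : Space R →L[ℝ] Space R := (hopL W₁ R i).restrictScalars ℝ
  let B : ℝ → (Space R →L[ℝ] Space R) := fun s => (slotEnvelope W₁ i s) • H
  let D : ℝ → (Space R →L[ℝ] Space R) := fun _ => (dampL 𝔸 γ₁ R).restrictScalars ℝ
  have hBapp : ∀ s y, B s y = (slotEnvelope W₁ i s) • hopL W₁ R i y := fun s y => rfl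
  have hDapp : ∀ s y, D s y = dampL 𝔸 γ₁ R y := fun s y => rfl
  have hB' : ∀ s (y v : Space R), ⟪B s y, v⟫_ℝ = -⟪y, B s v⟫_ℝ := by
    intro s y v
    rw [hBapp, hBapp, real_inner_smul_left, real_inner_smul_right, real_inner_hopL_comm W₁ R i y v]; ring
  have hDp : ∀ s (y : Space R), 0 ≤ ⟪D s y, y⟫_ℝ := fun s y => by rw [hDapp s]; exact real_inner_dampL_nonneg_all h𝔸 hlo' hγ₁ y
  -- the generator restricted to ℝ, pointwise, on the window
  have hgen : ∀ s ∈ Icc t₀ t₁, ∀ y, ((gen W₁ 𝔸 γ₁ R s).restrictScalars ℝ) y = B s y - D s y := by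
    intro s hs y
    rw [ContinuousLinearMap.coe_restrictScalars', gen_eq_of_slot W₁ 𝔸 γ₁ R i (hoff s hs), hBapp, hDapp s, sub_apply, smul_apply,
      ← Complex.coe_smul]
  -- `P` commutes with the generator on the window
  have hPgen : ∀ s ∈ Icc t₀ t₁, ∀ y, P (gen W₁ 𝔸 γ₁ R s y) = gen W₁ 𝔸 γ₁ R s (P y) := by
    intro s hs y
    rw [hPapp, hPapp, projX_gen_comm, maskL_gen_comm_of_slot W₁ 𝔸 γ₁ R i z₀ (hoff s hs)]
  -- the defect solves the same equation
  have hw : ∀ s ∈ Icc t₀ t₁, HasDerivAt w (B s (w s) - D s (w s)) s := by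
    intro s hs
    have h1 := hu s hs
    have h2 : HasDerivAt (fun r => P (u r)) (P (((gen W₁ 𝔸 γ₁ R s).restrictScalars ℝ) (u s))) s := P.hasFDerivAt.comp_hasDerivAt s h1
    have h3 := h1.sub h2
    have e : ((gen W₁ 𝔸 γ₁ R s).restrictScalars ℝ) (u s) - P (((gen W₁ 𝔸 γ₁ R s).restrictScalars ℝ) (u s)) = B s (w s) - D s (w s) := by
      rw [← hgen s hs (w s), hwapp, map_sub, ContinuousLinearMap.coe_restrictScalars', hPgen s hs]
    rw [e] at h3
    exact h3
  -- `‖w‖²` is non-increasing, and `w t₀ = 0`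
  have hanti := LadderCrush.norm_sq_antitoneOn B D w hB' hDp (fun s hs => by convert hw s hs using 2)
  have hw0 : w t₀ = 0 := by rw [hwapp, hPapp, maskL_projX_eq_self_of_mem_ladderSub h0, sub_self]
  have hle : ‖w t‖ ^ 2 ≤ ‖w t₀‖ ^ 2 := hanti (left_mem_Icc.2 (ht.1.trans ht.2)) ht ht.1
  rw [hw0, norm_zero, zero_pow two_ne_zero] at hle
  have hwt : w t = 0 := by
    have : ‖w t‖ ^ 2 = 0 := le_antisymm hle (sq_nonneg _)
    exact norm_eq_zero.1 (pow_eq_zero_iff two_ne_zero |>.1 this)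
  have hut : u t = P (u t) := sub_eq_zero.1 (by rw [← hwapp]; exact hwt)
  rw [hut, hPapp]
  exact maskL_projX_mem_ladderSub R _ (u t)

end Summit.AnomalousDissipation.AnomalousDissipation.Theorems.SolenoidalFractalHomogenisation.LagrangianStep.Sideband

end
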